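import Mathlib
import Summits.ABC.ABC.Statement

/-!
# The one-prime face of the exponential wall: Wieferich exponents (solo-ABC-informed, session 2)

For an odd prime `q` write `W(q) := v_q(2^{q-1} - 1) ≥ 1` (the *Wieferich exponent* of `q` to
base `2`; `q` is a Wieferich prime iff `W(q) ≥ 2`).  Two elementary facts organise the `p`-adic
side of every unconditional approach to `abc` on the thinnest natural family of abc triples,
`(1, 2^p - 1, 2^p)` with `p` prime:

* every prime factor `q` of `2^p - 1` has `ord_q(2) = p`, hence `p ∣ q - 1`, and — lifting the
  exponent — `v_q(2^p - 1) = v_q(2^{q-1} - 1) = W(q)`: the multiplicity of `q` in a Mersenne number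
  of prime exponent **is** the Wieferich exponent of `q`
  (`soloInformed_padicValNat_two_pow_sub_one`);
* consequently, if all but finitely many primes `q` had `W(q) ≥ M + 1`, then `2^p - 1` would be
  `(M+1)`-full for every large prime `p`, i.e. `rad(2^p - 1)^{M+1} ∣ 2^p - 1`
  (`soloInformed_radical_pow_dvd_mersenne_of_finite`).

Hence any bound `2^p ≤ K · rad(2^p - 1)^μ` valid for infinitely many primes `p`, with `μ < M + 1`,
forces infinitely many primes `q` with `q^{M+1} ∤ 2^{q-1} - 1`
(`soloInformed_infinite_not_wieferichPow_of_mersenneBound`).  In particular Oesterlé's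
*polynomial abc* `∃ M K, c ≤ K · rad(abc)^M` — the rung (W) of
`Summits/ABC/ABC/Theorems/SoloInformedWall.lean`, open — already implies, through its restriction to
this one family, that for some `M` infinitely many primes are at most `M`-fold Wieferich
(`soloInformed_infinite_not_wieferichPow_of_polynomialABC`), and `ABC` itself gives infinitely
many non-Wieferich primes to base `2` (`soloInformed_infinite_not_isWieferich_of_abc`; this is the
base-`2`, qualitative case of J. H. Silverman, *Wieferich's criterion and the abc-conjecture*,
J. Number Theory 30 (1988) 226–237, Theorem 1 [cite: Silverman1988, Thm 1], whose proof runs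
through squarefree parts of `a^n - b^n` for all `n`; the cyclotomic-prime-exponent shortcut used
here is the one of his Lemma 3).  No unconditional proof that infinitely many primes `q` satisfy
`q^{M+1} ∤ 2^{q-1} - 1` is known for any `M` ("we know neither that `W` is infinite, nor that its
complement is infinite", Silverman, op. cit., p. 228; "It is unknown whether there are infinitely
many non-Wieferich primes for some non-unit base", Graves–Weiss, arXiv:2503.19144, §1); no bound
on a single `W(q)` better than the trivial (Liouville) `q^{W(q)} ≤ 2^{q-1} - 1` appears in the
literature searched by the seat — this trivial bound is the factor `p` (in place of `log p`) of the
`p`-adic estimates for linear forms in logarithms, in their simplest instance `n = 1`.  These statements are the seat's report, §2bis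
(`run/shared/lean/ideation/ABC/solo-informed/paper/paper.md`). [folklore]
-/

namespace Summit.ABC.ABC.Theorems

open Literature.NumberTheory.DiophantineGeometry UniqueFactorizationMonoid

/-! ### Prime factors of Mersenne numbers of prime exponent -/

/-- `2^p - 1` is odd-prime-free of `2`: no prime factor of `2^p - 1` divides `2` (for `p ≥ 1`). [folklore] -/
theorem soloInformed_not_dvd_two_of_dvd_two_pow_sub_one {p q : ℕ} (hp : 0 < p) (hq : q.Prime)
    (hdvd : q ∣ 2 ^ p - 1) : ¬ q ∣ 2 := by
  intro h2
  have hq2 : q = 2 := (Nat.prime_dvd_prime_iff_eq hq Nat.prime_two).mp h2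
  subst hq2
  have h1 : 1 ≤ 2 ^ p := Nat.one_le_two_pow
  have : 2 ∣ 2 ^ p := dvd_pow_self 2 hp.ne'
  have h' : 2 ∣ 2 ^ p - (2 ^ p - 1) := Nat.dvd_sub this hdvd
  rw [Nat.sub_sub_self h1] at h'
  exact absurd h' (by norm_num)

/-- If a prime `q` divides `2^p - 1` with `p` prime, then `2` has order exactly `p` modulo `q`,
so `p ∣ q - 1` (Fermat). [folklore] -/
theorem soloInformed_prime_dvd_sub_one_of_dvd_two_pow_sub_one {p q : ℕ} (hp : p.Prime)
    (hq : q.Prime) (hdvd : q ∣ 2 ^ p - 1) : p ∣ q - 1 := by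
  haveI : Fact q.Prime := ⟨hq⟩
  haveI : Fact p.Prime := ⟨hp⟩
  have h1 : 1 ≤ 2 ^ p := Nat.one_le_two_pow
  have hcast : ((2 ^ p - 1 : ℕ) : ZMod q) = 0 := (ZMod.natCast_eq_zero_iff _ _).mpr hdvd
  have hpow : (2 : ZMod q) ^ p = 1 := by
    rw [Nat.cast_sub h1] at hcast
    push_cast at hcast
    exact sub_eq_zero.mp hcast
  have h2ne0 : (2 : ZMod q) ≠ 0 := by
    intro h
    have : q ∣ 2 := by
      have := (ZMod.natCast_eq_zero_iff 2 q).mp (by exact_mod_cast h)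
      exact this
    exact soloInformed_not_dvd_two_of_dvd_two_pow_sub_one hp.pos hq hdvd this
  have h2ne1 : (2 : ZMod q) ≠ 1 := by
    intro h
    have h1 : (1 : ZMod q) = 0 := by linear_combination h
    have h' : ((1 : ℕ) : ZMod q) = 0 := by rw [Nat.cast_one]; exact h1
    have : q ∣ 1 := (ZMod.natCast_eq_zero_iff 1 q).mp h'
    exact hq.one_lt.ne' (Nat.dvd_one.mp this)
  have hord : orderOf (2 : ZMod q) = p := orderOf_eq_prime hpow h2ne1
  have := ZMod.orderOf_dvd_card_sub_one h2ne0
  rwa [hord] at this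

/-- Prime factors of `2^p - 1` (`p` prime) exceed `p`. [folklore] -/
theorem soloInformed_lt_of_dvd_two_pow_sub_one {p q : ℕ} (hp : p.Prime) (hq : q.Prime)
    (hdvd : q ∣ 2 ^ p - 1) : p < q := by
  have h := soloInformed_prime_dvd_sub_one_of_dvd_two_pow_sub_one hp hq hdvd
  have hq1 : 0 < q - 1 := by have := hq.two_le; omega
  have := Nat.le_of_dvd hq1 h
  omega

/-- **Lifting the exponent on the Mersenne family.** If a prime `q` divides `2^p - 1` with `p`
prime, then `v_q(2^p - 1) = v_q(2^{q-1} - 1)`: the multiplicity of `q` in the Mersenne number is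
the Wieferich exponent of `q` to base `2`. (Write `q - 1 = p·m`; then
`v_q((2^p)^m - 1) = v_q(2^p - 1) + v_q(m)` and `0 < m < q`.) [folklore] -/
theorem soloInformed_padicValNat_two_pow_sub_one {p q : ℕ} (hp : p.Prime) (hq : q.Prime)
    (hdvd : q ∣ 2 ^ p - 1) :
    padicValNat q (2 ^ p - 1) = padicValNat q (2 ^ (q - 1) - 1) := by
  haveI : Fact q.Prime := ⟨hq⟩
  have hq2 : ¬ q ∣ 2 := soloInformed_not_dvd_two_of_dvd_two_pow_sub_one hp.pos hq hdvd
  have hqodd : Odd q := hq.odd_of_ne_two (by rintro rfl; exact hq2 dvd_rfl)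
  obtain ⟨m, hm⟩ := soloInformed_prime_dvd_sub_one_of_dvd_two_pow_sub_one hp hq hdvd
  have hpq : p < q := soloInformed_lt_of_dvd_two_pow_sub_one hp hq hdvd
  have hm0 : m ≠ 0 := by
    rintro rfl
    have := hq.two_le
    omega
  have hmq : ¬ q ∣ m := by
    intro h
    have hmpos : 0 < m := Nat.pos_of_ne_zero hm0
    have hle : q ≤ m := Nat.le_of_dvd hmpos h
    have : q - 1 = p * m := hm
    have hp2 : 2 ≤ p := hp.two_le
    have : 2 * m ≤ p * m := Nat.mul_le_mul_right m hp2
    omega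
  have hx : ¬ q ∣ 2 ^ p := fun h => hq2 (hq.dvd_of_dvd_pow h)
  have hyx : 1 < 2 ^ p := Nat.one_lt_two_pow hp.pos.ne'
  have hxy : q ∣ 2 ^ p - 1 := hdvd
  have key := padicValNat.pow_sub_pow (p := q) (x := 2 ^ p) (y := 1) hqodd hyx hxy hx hm0
  rw [one_pow, ← pow_mul, ← hm, padicValNat.eq_zero_of_not_dvd hmq, add_zero] at key
  exact key.symm

/-! ### Full numbers and radicals -/

/-- If every prime factor `q` of `n` satisfies `q^k ∣ n`, then `rad(n)^k ∣ n`
(for `n = 0` both sides are trivial since `rad 0 = 1`). [folklore] -/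
theorem soloInformed_radical_pow_dvd {n k : ℕ}
    (h : ∀ q ∈ n.primeFactors, q ^ k ∣ n) : radical n ^ k ∣ n := by
  rw [Nat.radical_eq_prod_primeFactors, ← Finset.prod_pow]
  apply Finset.prod_dvd_of_isRelPrime
  · intro a ha b hb hab
    have hpa : a.Prime := Nat.prime_of_mem_primeFactors ha
    have hpb : b.Prime := Nat.prime_of_mem_primeFactors hb
    have hcop : Nat.Coprime (a ^ k) (b ^ k) :=
      Nat.Coprime.pow k k ((Nat.coprime_primes hpa hpb).mpr hab)
    exact Nat.coprime_iff_isRelPrime.mp hcop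
  · exact h

/-- **Core.** If only finitely many primes `q` have `q^{M+1} ∤ 2^{q-1} - 1` (i.e. all but finitely
many primes are `(M+1)`-fold Wieferich to base `2`), then for every sufficiently large prime `p`
the Mersenne number `2^p - 1` is `(M+1)`-full: `rad(2^p - 1)^{M+1} ∣ 2^p - 1`. [folklore] -/
theorem soloInformed_radical_pow_dvd_mersenne_of_finite {M : ℕ}
    (hfin : {q : ℕ | q.Prime ∧ ¬ q ^ (M + 1) ∣ 2 ^ (q - 1) - 1}.Finite) :
    ∃ P : ℕ, ∀ p : ℕ, p.Prime → P < p → radical (2 ^ p - 1) ^ (M + 1) ∣ 2 ^ p - 1 := by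
  obtain ⟨P, hP⟩ := hfin.bddAbove
  refine ⟨P, fun p hp hPp => ?_⟩
  have hn : 2 ^ p - 1 ≠ 0 := by
    have := Nat.one_lt_two_pow hp.pos.ne'
    omega
  apply soloInformed_radical_pow_dvd
  intro q hq
  have hqprime : q.Prime := Nat.prime_of_mem_primeFactors hq
  have hqdvd : q ∣ 2 ^ p - 1 := Nat.dvd_of_mem_primeFactors hq
  haveI : Fact q.Prime := ⟨hqprime⟩
  have hpq : p < q := soloInformed_lt_of_dvd_two_pow_sub_one hp hqprime hqdvd
  have hW : q ^ (M + 1) ∣ 2 ^ (q - 1) - 1 := by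
    by_contra hnot
    have hle : q ≤ P := hP ⟨hqprime, hnot⟩
    omega
  have hq1 : 2 ^ (q - 1) - 1 ≠ 0 := by
    have h2 : 2 ≤ q - 1 := by
      have := hqprime.two_le
      have hq3 : q ≠ 2 := by
        rintro rfl
        exact soloInformed_not_dvd_two_of_dvd_two_pow_sub_one hp.pos Nat.prime_two hqdvd dvd_rfl
      omega
    have : 4 ≤ 2 ^ (q - 1) := by
      calc (4 : ℕ) = 2 ^ 2 := by norm_num
        _ ≤ 2 ^ (q - 1) := Nat.pow_le_pow_right (by norm_num) h2
    omega
  have hv : M + 1 ≤ padicValNat q (2 ^ (q - 1) - 1) := (padicValNat_dvd_iff_le hq1).mp hW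
  rw [← soloInformed_padicValNat_two_pow_sub_one hp hqprime hqdvd] at hv
  exact (padicValNat_dvd_iff_le hn).mpr hv

/-! ### From radical bounds on the family to bounded Wieferich exponents -/

/-- **The one-prime face.** Let `0 ≤ μ < M + 1`. If `2^p ≤ K · rad(2^p - 1)^μ` holds for
infinitely many primes `p`, then infinitely many primes `q` satisfy `q^{M+1} ∤ 2^{q-1} - 1`
(i.e. have Wieferich exponent `≤ M`). Contrapositive of the core: an `(M+1)`-full `2^p - 1` has
`rad(2^p - 1) ≤ 2^{p/(M+1)}`, incompatible with the bound for large `p`. [folklore] -/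
theorem soloInformed_infinite_not_wieferichPow_of_mersenneBound {μ K : ℝ} {M : ℕ}
    (hμ0 : 0 ≤ μ) (hμ : μ < M + 1)
    (hinf : {p : ℕ | p.Prime ∧ (2 : ℝ) ^ p ≤ K * ((radical (2 ^ p - 1) : ℕ) : ℝ) ^ μ}.Infinite) :
    {q : ℕ | q.Prime ∧ ¬ q ^ (M + 1) ∣ 2 ^ (q - 1) - 1}.Infinite := by
  by_contra hfin
  rw [Set.not_infinite] at hfin
  obtain ⟨P, hP⟩ := soloInformed_radical_pow_dvd_mersenne_of_finite hfin
  -- the exponent gap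
  set t : ℝ := (M : ℝ) + 1 with ht
  have ht0 : 0 < t := by rw [ht]; positivity
  set δ : ℝ := 1 - μ / t with hδ
  have hδ0 : 0 < δ := by
    rw [hδ, sub_pos, div_lt_one ht0]; exact hμ
  -- K must be positive (some prime p is in the set)
  obtain ⟨p₀, hp₀⟩ := hinf.nonempty
  have hK : 0 < K := by
    have h1 : (0 : ℝ) < (2 : ℝ) ^ p₀ := by positivity
    have h2 : (0 : ℝ) < ((radical (2 ^ p₀ - 1) : ℕ) : ℝ) ^ μ := by
      apply Real.rpow_pos_of_pos
      exact_mod_cast Nat.radical_pos _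
    have := hp₀.2
    nlinarith
  -- a bound B with: p prime, P < p, 2^p ≤ K rad^μ ⟹ 2^p ≤ B
  set B : ℝ := K ^ (1 / δ) with hB
  -- every element of the infinite set is ≤ max P (something)
  have hsub : {p : ℕ | p.Prime ∧ (2 : ℝ) ^ p ≤ K * ((radical (2 ^ p - 1) : ℕ) : ℝ) ^ μ} ⊆
      {p : ℕ | p ≤ P ∨ (2 : ℝ) ^ p ≤ B} := by
    intro p hp
    obtain ⟨hpprime, hbound⟩ := hp
    by_cases hpP : p ≤ P
    · exact Or.inl hpP
    right
    push Not at hpP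
    have hfull := hP p hpprime hpP
    have hn : 2 ^ p - 1 ≠ 0 := by
      have := Nat.one_lt_two_pow hpprime.pos.ne'
      omega
    -- rad^(M+1) ≤ 2^p - 1 < 2^p
    have hle_nat : radical (2 ^ p - 1) ^ (M + 1) ≤ 2 ^ p - 1 := Nat.le_of_dvd (Nat.pos_of_ne_zero hn) hfull
    have hlt_nat : radical (2 ^ p - 1) ^ (M + 1) < 2 ^ p := by
      have : 2 ^ p - 1 < 2 ^ p := Nat.sub_lt (by positivity) one_pos
      omega
    set r : ℝ := ((radical (2 ^ p - 1) : ℕ) : ℝ) with hr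
    have hr0 : 0 < r := by rw [hr]; exact_mod_cast Nat.radical_pos _
    have hX0 : (0 : ℝ) < (2 : ℝ) ^ p := by positivity
    have hrt : r ^ t < (2 : ℝ) ^ p := by
      rw [ht, show (M : ℝ) + 1 = ((M + 1 : ℕ) : ℝ) by push_cast; ring, Real.rpow_natCast, hr]
      exact_mod_cast hlt_nat
    -- r < (2^p)^(1/t)
    have hr_lt : r < ((2 : ℝ) ^ p) ^ (1 / t) := by
      have h1 : r = (r ^ t) ^ (1 / t) := by
        rw [← Real.rpow_mul hr0.le, mul_one_div_cancel ht0.ne', Real.rpow_one]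
      rw [h1]
      exact Real.rpow_lt_rpow (by positivity) hrt (by positivity)
    -- r^μ ≤ (2^p)^(μ/t)
    have hrμ : r ^ μ ≤ ((2 : ℝ) ^ p) ^ (μ / t) := by
      have := Real.rpow_le_rpow hr0.le hr_lt.le hμ0
      rwa [← Real.rpow_mul hX0.le, one_div_mul_eq_div] at this
    -- 2^p ≤ K (2^p)^(μ/t) ⟹ (2^p)^δ ≤ K
    have h1 : (2 : ℝ) ^ p ≤ K * ((2 : ℝ) ^ p) ^ (μ / t) := le_trans hbound (by gcongr)
    have h2 : ((2 : ℝ) ^ p) ^ δ ≤ K := by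
      rw [hδ, Real.rpow_sub hX0, Real.rpow_one, div_le_iff₀ (by positivity)]
      exact h1
    -- hence 2^p ≤ K^(1/δ)
    have h3 : (2 : ℝ) ^ p ≤ K ^ (1 / δ) := by
      have := Real.rpow_le_rpow (by positivity) h2 (le_of_lt (by positivity : (0:ℝ) < 1 / δ))
      rwa [← Real.rpow_mul hX0.le, mul_one_div_cancel hδ0.ne', Real.rpow_one] at this
    rw [hB]; exact h3
  -- the right-hand set is finite
  have hfin2 : {p : ℕ | p ≤ P ∨ (2 : ℝ) ^ p ≤ B}.Finite := by
    obtain ⟨N, hN⟩ : ∃ N : ℕ, B < (2 : ℝ) ^ N := by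
      obtain ⟨N, hN⟩ := pow_unbounded_of_one_lt B (by norm_num : (1 : ℝ) < 2)
      exact ⟨N, hN⟩
    apply Set.Finite.subset (Set.finite_Iic (max P N))
    intro p hp
    rcases hp with hp | hp
    · exact le_trans hp (le_max_left _ _)
    · have : p ≤ N := by
        by_contra hcon
        push Not at hcon
        have : (2 : ℝ) ^ N < (2 : ℝ) ^ p := pow_lt_pow_right₀ (by norm_num) hcon
        linarith
      exact le_trans this (le_max_right _ _)
  exact hinf (hfin2.subset hsub)

/-! ### Consequences for the rungs of the wall -/

/-- `(1, 2^p - 1, 2^p)` is an abc triple for `p ≥ 1`. [folklore] -/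
theorem soloInformed_isABCTriple_mersenne {p : ℕ} (hp : 0 < p) :
    IsABCTriple 1 (2 ^ p - 1) (2 ^ p) := by
  have h1 : 1 < 2 ^ p := Nat.one_lt_two_pow hp.ne'
  refine ⟨one_pos, by omega, by omega, Nat.coprime_one_left _⟩

/-- The radical of the Mersenne triple is at most `2 · rad(2^p - 1)`. [folklore] -/
theorem soloInformed_rad_mersenne_le {p : ℕ} (hp : 0 < p) :
    rad 1 (2 ^ p - 1) (2 ^ p) ≤ 2 * radical (2 ^ p - 1) := by
  rw [rad_def, one_mul]
  have hdvd : radical ((2 ^ p - 1) * 2 ^ p) ∣ radical (2 ^ p - 1) * radical (2 ^ p) :=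
    radical_mul_dvd
  have h2 : radical ((2 : ℕ) ^ p) = 2 := by
    rw [radical_pow_of_prime Nat.prime_two.prime hp.ne']
    simp
  rw [h2] at hdvd
  have hpos : 0 < radical (2 ^ p - 1) * 2 := by positivity
  have := Nat.le_of_dvd hpos hdvd
  linarith

/-- **Polynomial abc ⟹ bounded Wieferich exponents infinitely often.** Oesterlé's polynomial
abc (rung (W): `∃ M K, ∀ abc triples, c ≤ K · rad(abc)^M`), restricted to the Mersenne family,
gives some `M` such that infinitely many primes `q` satisfy `q^{M+1} ∤ 2^{q-1} - 1`. The
conclusion is not known unconditionally for any `M`. [folklore] -/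
theorem soloInformed_infinite_not_wieferichPow_of_polynomialABC
    (h : ∃ M : ℕ, ∃ K : ℝ, 0 < K ∧
      ∀ a b c : ℕ, IsABCTriple a b c → (c : ℝ) ≤ K * ((rad a b c : ℕ) : ℝ) ^ M) :
    ∃ M : ℕ, {q : ℕ | q.Prime ∧ ¬ q ^ (M + 1) ∣ 2 ^ (q - 1) - 1}.Infinite := by
  obtain ⟨M, K, hK, hW⟩ := h
  refine ⟨M, soloInformed_infinite_not_wieferichPow_of_mersenneBound (μ := (M : ℝ))
    (K := K * 2 ^ (M : ℝ)) (M := M) (by positivity) (by linarith) ?_⟩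
  apply Set.infinite_of_forall_exists_gt
  intro N
  obtain ⟨p, hNp, hp⟩ := Nat.exists_infinite_primes (N + 1)
  refine ⟨p, ⟨hp, ?_⟩, by omega⟩
  have hp0 : 0 < p := hp.pos
  have h1 := hW 1 (2 ^ p - 1) (2 ^ p) (soloInformed_isABCTriple_mersenne hp0)
  have hradle : ((rad 1 (2 ^ p - 1) (2 ^ p) : ℕ) : ℝ) ≤ 2 * ((radical (2 ^ p - 1) : ℕ) : ℝ) := by
    exact_mod_cast soloInformed_rad_mersenne_le hp0
  have hr0 : (0 : ℝ) ≤ ((rad 1 (2 ^ p - 1) (2 ^ p) : ℕ) : ℝ) := by positivity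
  have hR0 : (0 : ℝ) < ((radical (2 ^ p - 1) : ℕ) : ℝ) := by exact_mod_cast Nat.radical_pos _
  calc ((2 : ℝ)) ^ p = ((2 ^ p : ℕ) : ℝ) := by push_cast; ring
    _ ≤ K * ((rad 1 (2 ^ p - 1) (2 ^ p) : ℕ) : ℝ) ^ M := h1
    _ ≤ K * (2 * ((radical (2 ^ p - 1) : ℕ) : ℝ)) ^ M := by gcongr
    _ = K * 2 ^ (M : ℝ) * ((radical (2 ^ p - 1) : ℕ) : ℝ) ^ (M : ℝ) := by
        rw [mul_pow, Real.rpow_natCast, Real.rpow_natCast]; ring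

/-- **`ABC` ⟹ infinitely many non-Wieferich primes to base 2** (the base-`2`, qualitative case of
Silverman 1988, Theorem 1), through the Mersenne family: `ABC` with `ε = 1/2` bounds
`2^p < C · (2·rad(2^p - 1))^{3/2}`, and `3/2 < 2`. [cite: Silverman1988, Thm 1] -/
theorem soloInformed_infinite_not_isWieferich_of_abc (h : _root_.ABC) :
    {q : ℕ | q.Prime ∧ ¬ IsWieferich 2 q}.Infinite := by
  obtain ⟨C, hC, hC'⟩ := (_root_.ABC_iff.mp h) (1 / 2) (by norm_num)
  have key : {q : ℕ | q.Prime ∧ ¬ q ^ (1 + 1) ∣ 2 ^ (q - 1) - 1}.Infinite := by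
    refine soloInformed_infinite_not_wieferichPow_of_mersenneBound (μ := (3 / 2 : ℝ))
      (K := C * 2 ^ (3 / 2 : ℝ)) (M := 1) (by norm_num) (by norm_num) ?_
    apply Set.infinite_of_forall_exists_gt
    intro N
    obtain ⟨p, hNp, hp⟩ := Nat.exists_infinite_primes (N + 1)
    refine ⟨p, ⟨hp, ?_⟩, by omega⟩
    have hp0 : 0 < p := hp.pos
    have h1 := hC' 1 (2 ^ p - 1) (2 ^ p) (soloInformed_isABCTriple_mersenne hp0)
    have hradle : ((rad 1 (2 ^ p - 1) (2 ^ p) : ℕ) : ℝ) ≤ 2 * ((radical (2 ^ p - 1) : ℕ) : ℝ) := by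
      exact_mod_cast soloInformed_rad_mersenne_le hp0
    have hr0 : (0 : ℝ) ≤ ((rad 1 (2 ^ p - 1) (2 ^ p) : ℕ) : ℝ) := by positivity
    have hR0 : (0 : ℝ) < ((radical (2 ^ p - 1) : ℕ) : ℝ) := by exact_mod_cast Nat.radical_pos _
    have hexp : (0 : ℝ) ≤ 1 + 1 / 2 := by norm_num
    calc ((2 : ℝ)) ^ p = ((2 ^ p : ℕ) : ℝ) := by push_cast; ring
      _ ≤ C * ((rad 1 (2 ^ p - 1) (2 ^ p) : ℕ) : ℝ) ^ (1 + 1 / 2 : ℝ) := h1.le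
      _ ≤ C * (2 * ((radical (2 ^ p - 1) : ℕ) : ℝ)) ^ (1 + 1 / 2 : ℝ) := by
          gcongr
      _ = C * 2 ^ (3 / 2 : ℝ) * ((radical (2 ^ p - 1) : ℕ) : ℝ) ^ (3 / 2 : ℝ) := by
          rw [Real.mul_rpow (by norm_num) hR0.le]; norm_num; ring
  apply key.mono
  rintro q ⟨hq, hnot⟩
  refine ⟨hq, fun hw => hnot ?_⟩
  -- IsWieferich 2 q : 2^(q-1) ≡ 1 [MOD q^2]
  have h1 : 1 ≤ 2 ^ (q - 1) := Nat.one_le_two_pow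
  have : q ^ 2 ∣ 2 ^ (q - 1) - 1 := (Nat.modEq_iff_dvd' h1).mp hw.symm
  simpa [pow_succ] using this

end Summit.ABC.ABC.Theorems
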